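import Mathlib
import HarnessLib
import Summits.Ventures.LatticeQCDFlow.Exactness.IMHKernel

/-!
# LatticeQCDFlow / Exactness — THE NAIVE RETRY IS NOT EXACT: re-testing a fresh flow draw with the PLAIN Metropolis ratio after a
# rejection biases the sampled law toward the flow (defect identity on a general state space + a two-point witness)

HONEST FRAMING: exact (Metropolis-corrected) sampling algorithms for lattice gauge theory;
figures of merit are autocorrelation/cost numbers at stated couplings and volumes; no
continuum-physics claim.

Venture `LatticeQCDFlow` (cell pub-lqcd), topic `Exactness`, FANOUT row 30 (lean-1 GEN-43, theme SECOND CHANCES; the cautionary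
twin of `IMHDelayedRejectionExact`).  NEW WORK of the cell over `IMHKernel` (`imhAcceptE`, `imhAcceptMass`, `ofReal_mul_imhAcceptE`);
no definition is introduced, nothing is cited as a fact.  Printed counterpart of the correct rule, NAMED ONLY: Tierney–Mira 1999 §4
(the second stage must be priced by the ratio of the REVERSED two-stage path, `IMHDelayedRejectionExact`); that the un-priced retry is
wrong is folklore (e.g. the warnings in Tierney–Mira's §4 and in Green–Mira 2001 §2) — typed here because the shortcut is tempting on
batched hardware ("if the flow sample is rejected, just test the next one").

## The naive retry (general measurable `Ω`; flow law `q`; weight `w > 0`; `a = min(1, w(y)/w(x))`, `A(x) = ∫ a(x, ·) dq`; `π = w·q`)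

From `x`: draw `y₁ ∼ q`, accept with probability `a(x, y₁)`; IF REJECTED draw a fresh `y₂ ∼ q` and accept it with the SAME plain
probability `a(x, y₂)`; else stay.  Def-free: ANY kernel `K` with
`K(x, B) = ∫_B a(x, y) dq + (1 − A(x))·∫_B a(x, y) dq + (1 − A(x))·(1 − A(x))·1_B(x)` (hypothesis `hK`; the three branches).

## Results [all ours]

* `naiveRetry_apply_univ` ∕ `naiveRetry_isMarkovKernel`: the three branches are one probability law.
* **`naiveRetry_bind_apply_add` (THE DEFECT IDENTITY)**: for every measurable `B`,
  `(πK)(B) + ∫_B ∫ (1 − A(y))·min(w(x), w(y)) q(dx) q(dy) = π(B) + ∫_B ∫ (1 − A(x))·min(w(x), w(y)) q(dx) q(dy)`: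
  `π` is invariant exactly when the first-stage REJECTION PROBABILITY can be moved from the landing point `y` to the launching point
  `x` under the symmetric flux `min(w(x), w(y))`.  Since `A` is large where the weight is small (the flow over-covers), the retry
  chain GAINS mass where `A(y)` exceeds its flux-average — it drifts toward the flow's own law `q`.
* `naiveRetry_invariant_of_acceptMass_const`: if `A` is constant the naive retry IS exact (e.g. a perfect flow) — the identity is sharp.
* **`naiveRetry_not_invariant` (WITNESS)**: on `Ω = Bool` with `q` uniform and `w(false) = 1`, `w(true) = 2` (so `A(false) = 1`,
  `A(true) = 3/4`, `π({false}) = 1/2`): EVERY kernel realising the naive retry has `(πK)({false}) = 9/16 ≠ π({false})` — the light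
  configuration, which the flow over-proposes, is over-sampled by `1/16` after one step from equilibrium.

Not here: `m > 1` retries (the defect is `∫_B ∫ min(w x, w y)(S(x) − S(y))`, `S = Σ_{k≤m}(1 − A)ᵏ`, same proof), the size of the
stationary bias of the retry chain, "retry until accepted" (its kernel is the jump kernel `a q/A`, exact for the TILT `A·π`, in the
tree as `Scoring.imhJump_invariant` — not for `π`).
-/

namespace Summit.Ventures.LatticeQCDFlow.Exactness

open MeasureTheory ProbabilityTheory
open scoped ENNReal

variable {Ω : Type*} [MeasurableSpace Ω] {q : Measure Ω} [IsProbabilityMeasure q] {w : Ω → ℝ}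

/-! ## §1 The naive-retry kernel is Markov -/

/-- `K(x, Ω) = A + (1 − A)·A + (1 − A)(1 − A) = A + (1 − A)·(A + (1 − A)) = 1`. [ours] -/
theorem naiveRetry_apply_univ (K : Kernel Ω Ω)
    (hK : ∀ (x : Ω) {B : Set Ω}, MeasurableSet B → K x B =
      ∫⁻ y in B, imhAcceptE w x y ∂q + (1 - imhAcceptMass q w x) * ∫⁻ y in B, imhAcceptE w x y ∂q +
        (1 - imhAcceptMass q w x) * (1 - imhAcceptMass q w x) * B.indicator 1 x)
    (x : Ω) : K x Set.univ = 1 := by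
  rw [hK x MeasurableSet.univ, Measure.restrict_univ, Set.indicator_univ, Pi.one_apply, mul_one,
    show ∫⁻ y, imhAcceptE w x y ∂q = imhAcceptMass q w x from rfl, add_assoc, ← mul_add,
    add_tsub_cancel_of_le (imhAcceptMass_le_one q w x), mul_one, add_tsub_cancel_of_le (imhAcceptMass_le_one q w x)]

/-- Hence `K` is a Markov kernel. [ours, bookkeeping] -/
theorem naiveRetry_isMarkovKernel (K : Kernel Ω Ω)
    (hK : ∀ (x : Ω) {B : Set Ω}, MeasurableSet B → K x B =
      ∫⁻ y in B, imhAcceptE w x y ∂q + (1 - imhAcceptMass q w x) * ∫⁻ y in B, imhAcceptE w x y ∂q +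
        (1 - imhAcceptMass q w x) * (1 - imhAcceptMass q w x) * B.indicator 1 x) :
    IsMarkovKernel K :=
  ⟨fun x => ⟨naiveRetry_apply_univ K hK x⟩⟩

/-! ## §2 The defect identity -/

omit [IsProbabilityMeasure q] in
/-- **The flux of the plain step**: `∫ w(x)·a(x, y) q(dx) … = ∫ min(w x, w y) …` and `∫_Ω min(w(x), w(y)) q(dx) = w(y)·A(y)`. [ours] -/
theorem lintegral_min_weight_eq (hw : Measurable w) (hw0 : ∀ x, 0 < w x) (y : Ω) :
    ∫⁻ x, ENNReal.ofReal (min (w x) (w y)) ∂q = ENNReal.ofReal (w y) * imhAcceptMass q w y := by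
  rw [imhAcceptMass, ← lintegral_const_mul _ ((measurable_imhAcceptE hw).of_uncurry_left)]
  refine lintegral_congr fun x => ?_
  rw [ofReal_mul_imhAcceptE hw0, min_comm]

/-- **`π`'S MASS OF `B` SPLIT BY THE FIRST STAGE**: `π(B) = ∫_B ∫ min(w x, w y) q(dx) q(dy) + ∫_B w(y)(1 − A(y)) q(dy)`. [ours] -/
theorem withDensity_apply_eq_flux_add (hw : Measurable w) (hw0 : ∀ x, 0 < w x) {B : Set Ω} (hB : MeasurableSet B) :
    (q.withDensity fun y => ENNReal.ofReal (w y)) B =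
      ∫⁻ y in B, ∫⁻ x, ENNReal.ofReal (min (w x) (w y)) ∂q ∂q +
        ∫⁻ y in B, ENNReal.ofReal (w y) * (1 - imhAcceptMass q w y) ∂q := by
  have hm : Measurable fun y => ENNReal.ofReal (w y) * imhAcceptMass q w y :=
    hw.ennreal_ofReal.mul (measurable_imhAcceptMass q hw)
  rw [withDensity_apply _ hB]
  simp_rw [lintegral_min_weight_eq hw hw0]
  rw [← lintegral_add_left hm]
  refine lintegral_congr fun y => ?_
  rw [← mul_add, add_tsub_cancel_of_le (imhAcceptMass_le_one q w y), mul_one]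

/-- **`(πK)(B)` SPLIT BY THE THREE BRANCHES**:
`(πK)(B) = ∫_B ∫ min(w x, w y) q(dx) q(dy) + ∫_B ∫ (1 − A(x))·min(w x, w y) q(dx) q(dy) + ∫_B w(y)(1 − A(y))² q(dy)`. [ours] -/
theorem naiveRetry_bind_apply (hw : Measurable w) (hw0 : ∀ x, 0 < w x) (K : Kernel Ω Ω)
    (hK : ∀ (x : Ω) {B : Set Ω}, MeasurableSet B → K x B =
      ∫⁻ y in B, imhAcceptE w x y ∂q + (1 - imhAcceptMass q w x) * ∫⁻ y in B, imhAcceptE w x y ∂q +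
        (1 - imhAcceptMass q w x) * (1 - imhAcceptMass q w x) * B.indicator 1 x)
    {B : Set Ω} (hB : MeasurableSet B) :
    ((q.withDensity fun y => ENNReal.ofReal (w y)).bind K) B =
      ∫⁻ y in B, ∫⁻ x, ENNReal.ofReal (min (w x) (w y)) ∂q ∂q +
        ∫⁻ y in B, ∫⁻ x, (1 - imhAcceptMass q w x) * ENNReal.ofReal (min (w x) (w y)) ∂q ∂q +
        ∫⁻ y in B, ENNReal.ofReal (w y) * ((1 - imhAcceptMass q w y) * (1 - imhAcceptMass q w y)) ∂q := by
  have hd : Measurable fun x => ENNReal.ofReal (w x) := hw.ennreal_ofReal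
  have hR : Measurable fun x => 1 - imhAcceptMass q w x := measurable_const.sub (measurable_imhAcceptMass q hw)
  have ha : Measurable (Function.uncurry (imhAcceptE w)) := measurable_imhAcceptE hw
  have hI : Measurable fun x => ∫⁻ y in B, imhAcceptE w x y ∂q := by
    have : Measurable fun x => ∫⁻ y, B.indicator (fun y => imhAcceptE w x y) y ∂q :=
      (Measurable.indicator ha (measurable_snd hB) :
        Measurable fun p : Ω × Ω => B.indicator (fun y => imhAcceptE w p.1 y) p.2).lintegral_prod_right'
    simpa only [lintegral_indicator hB] using this
  have hmin : Measurable (Function.uncurry fun x y : Ω => ENNReal.ofReal (min (w x) (w y))) :=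
    ((hw.comp measurable_fst).min (hw.comp measurable_snd)).ennreal_ofReal
  rw [Measure.bind_apply hB (Kernel.aemeasurable _), lintegral_withDensity_eq_lintegral_mul _ hd (Kernel.measurable_coe K hB)]
  simp only [Pi.mul_apply]
  have hpt : ∀ x, ENNReal.ofReal (w x) * K x B =
      ENNReal.ofReal (w x) * ∫⁻ y in B, imhAcceptE w x y ∂q +
        (1 - imhAcceptMass q w x) * (ENNReal.ofReal (w x) * ∫⁻ y in B, imhAcceptE w x y ∂q) +
        B.indicator (fun x => ENNReal.ofReal (w x) * ((1 - imhAcceptMass q w x) * (1 - imhAcceptMass q w x))) x := by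
    intro x
    rw [hK x hB, mul_add, mul_add]
    congr 1
    · rw [mul_left_comm]
    · by_cases hx : x ∈ B
      · rw [Set.indicator_of_mem hx, Set.indicator_of_mem hx, Pi.one_apply, mul_one]
      · rw [Set.indicator_of_notMem hx, Set.indicator_of_notMem hx, mul_zero, mul_zero]
  simp_rw [hpt]
  have h1m : Measurable fun x => ENNReal.ofReal (w x) * ∫⁻ y in B, imhAcceptE w x y ∂q := hd.mul hI
  have hind : Measurable (B.indicator fun x => ENNReal.ofReal (w x) * ((1 - imhAcceptMass q w x) * (1 - imhAcceptMass q w x))) :=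
    (show Measurable fun x => ENNReal.ofReal (w x) * ((1 - imhAcceptMass q w x) * (1 - imhAcceptMass q w x)) from
      hd.mul (hR.mul hR)).indicator hB
  rw [lintegral_add_right _ hind, lintegral_add_left h1m, lintegral_indicator hB]
  -- flux form of the first two terms
  have hflux : ∀ x, ENNReal.ofReal (w x) * ∫⁻ y in B, imhAcceptE w x y ∂q = ∫⁻ y in B, ENNReal.ofReal (min (w x) (w y)) ∂q := by
    intro x
    rw [← lintegral_const_mul _ (ha.of_uncurry_left)]
    exact lintegral_congr fun y => ofReal_mul_imhAcceptE hw0 x y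
  simp_rw [hflux]
  congr 1; congr 1
  · exact lintegral_lintegral_swap (hmin.aemeasurable (μ := q.prod (q.restrict B)))
  · rw [← lintegral_lintegral_swap (((hR.comp measurable_fst).mul hmin).aemeasurable (μ := q.prod (q.restrict B)))]
    refine lintegral_congr fun x => ?_
    rw [lintegral_const_mul _ (hmin.of_uncurry_left)]

/-- **THE DEFECT IDENTITY OF THE NAIVE RETRY.**  For every measurable `B`:
`(πK)(B) + ∫_B ∫ (1 − A(y))·min(w x, w y) q(dx) q(dy) = π(B) + ∫_B ∫ (1 − A(x))·min(w x, w y) q(dx) q(dy)` —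
`π` is invariant iff the first-stage rejection probability can be moved from the landing point to the launching point under the
symmetric flux. [ours] -/
theorem naiveRetry_bind_apply_add (hw : Measurable w) (hw0 : ∀ x, 0 < w x) (K : Kernel Ω Ω)
    (hK : ∀ (x : Ω) {B : Set Ω}, MeasurableSet B → K x B =
      ∫⁻ y in B, imhAcceptE w x y ∂q + (1 - imhAcceptMass q w x) * ∫⁻ y in B, imhAcceptE w x y ∂q +
        (1 - imhAcceptMass q w x) * (1 - imhAcceptMass q w x) * B.indicator 1 x)
    {B : Set Ω} (hB : MeasurableSet B) :
    ((q.withDensity fun y => ENNReal.ofReal (w y)).bind K) B +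
        ∫⁻ y in B, ∫⁻ x, (1 - imhAcceptMass q w y) * ENNReal.ofReal (min (w x) (w y)) ∂q ∂q =
      (q.withDensity fun y => ENNReal.ofReal (w y)) B +
        ∫⁻ y in B, ∫⁻ x, (1 - imhAcceptMass q w x) * ENNReal.ofReal (min (w x) (w y)) ∂q ∂q := by
  have hmin : Measurable (Function.uncurry fun x y : Ω => ENNReal.ofReal (min (w x) (w y))) :=
    ((hw.comp measurable_fst).min (hw.comp measurable_snd)).ennreal_ofReal
  have hR : Measurable fun x => 1 - imhAcceptMass q w x := measurable_const.sub (measurable_imhAcceptMass q hw)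
  have hT3 : Measurable fun y => ENNReal.ofReal (w y) * ((1 - imhAcceptMass q w y) * (1 - imhAcceptMass q w y)) :=
    hw.ennreal_ofReal.mul (hR.mul hR)
  -- rejection at the landing point: `∫ (1 − A y) min dq(x) = (1 − A y)·w(y)·A(y)`
  have hland : ∀ y, ∫⁻ x, (1 - imhAcceptMass q w y) * ENNReal.ofReal (min (w x) (w y)) ∂q =
      ENNReal.ofReal (w y) * ((1 - imhAcceptMass q w y) * imhAcceptMass q w y) := by
    intro y
    rw [lintegral_const_mul _ (hmin.of_uncurry_right), lintegral_min_weight_eq hw hw0, mul_left_comm]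
  have key : ∫⁻ y in B, ENNReal.ofReal (w y) * ((1 - imhAcceptMass q w y) * (1 - imhAcceptMass q w y)) ∂q +
      ∫⁻ y in B, ENNReal.ofReal (w y) * ((1 - imhAcceptMass q w y) * imhAcceptMass q w y) ∂q =
      ∫⁻ y in B, ENNReal.ofReal (w y) * (1 - imhAcceptMass q w y) ∂q := by
    rw [← lintegral_add_left hT3]
    refine lintegral_congr fun y => ?_
    rw [← mul_add, ← mul_add, tsub_add_cancel_of_le (imhAcceptMass_le_one q w y), mul_one]
  rw [naiveRetry_bind_apply hw hw0 K hK hB, withDensity_apply_eq_flux_add hw hw0 hB]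
  simp_rw [hland]
  rw [add_assoc, key, add_assoc, add_assoc]
  congr 1
  exact add_comm _ _

/-- **SHARPNESS: A CONSTANT ACCEPTANCE MASS MAKES THE NAIVE RETRY EXACT** (e.g. a perfect flow, `w ≡ 1`): if `A(x) = c` for all `x`
then `πK = π` on every measurable set of finite flux. [ours] -/
theorem naiveRetry_bind_apply_eq_of_acceptMass_const (hw : Measurable w) (hw0 : ∀ x, 0 < w x) (K : Kernel Ω Ω)
    (hK : ∀ (x : Ω) {B : Set Ω}, MeasurableSet B → K x B =
      ∫⁻ y in B, imhAcceptE w x y ∂q + (1 - imhAcceptMass q w x) * ∫⁻ y in B, imhAcceptE w x y ∂q +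
        (1 - imhAcceptMass q w x) * (1 - imhAcceptMass q w x) * B.indicator 1 x)
    {c : ℝ≥0∞} (hc : ∀ x, imhAcceptMass q w x = c) {B : Set Ω} (hB : MeasurableSet B)
    (hfin : ∫⁻ y in B, ∫⁻ x, (1 - c) * ENNReal.ofReal (min (w x) (w y)) ∂q ∂q ≠ ⊤) :
    ((q.withDensity fun y => ENNReal.ofReal (w y)).bind K) B = (q.withDensity fun y => ENNReal.ofReal (w y)) B := by
  have h := naiveRetry_bind_apply_add hw hw0 K hK hB
  simp_rw [hc] at h
  exact (ENNReal.add_left_inj hfin).1 h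

/-! ## §3 The two-point witness: `Ω = Bool`, `q` uniform, `w(false) = 1`, `w(true) = 2` -/

section NaiveRetryWitness

variable {q : Measure Bool} {w : Bool → ℝ}

/-- Integration against the uniform law on `Bool`. [ours, bookkeeping] -/
theorem NaiveRetryWitness.lintegral_eq (hq : ∀ b, q {b} = ENNReal.ofReal 2⁻¹) (g : Bool → ℝ≥0∞) :
    ∫⁻ b, g b ∂q = g false * ENNReal.ofReal 2⁻¹ + g true * ENNReal.ofReal 2⁻¹ := by
  rw [lintegral_fintype, Fintype.sum_bool, hq, hq, add_comm]

/-- Integration over `{false}` against the uniform law on `Bool`. [ours, bookkeeping] -/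
theorem NaiveRetryWitness.setLIntegral_false_eq (hq : ∀ b, q {b} = ENNReal.ofReal 2⁻¹) (g : Bool → ℝ≥0∞) :
    ∫⁻ b in {false}, g b ∂q = g false * ENNReal.ofReal 2⁻¹ := by
  rw [lintegral_singleton, hq]

/-- The four acceptance probabilities of the witness. [ours, bookkeeping] -/
theorem NaiveRetryWitness.imhAcceptE_eq (hwf : w false = 1) (hwt : w true = 2) :
    imhAcceptE w false false = 1 ∧ imhAcceptE w false true = 1 ∧
      imhAcceptE w true false = ENNReal.ofReal 2⁻¹ ∧ imhAcceptE w true true = 1 := by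
  simp only [imhAcceptE, imhAccept, hwf, hwt]
  norm_num

/-- The two acceptance masses of the witness: `A(false) = 1`, `A(true) = 3/4`. [ours, bookkeeping] -/
theorem NaiveRetryWitness.imhAcceptMass_eq (hq : ∀ b, q {b} = ENNReal.ofReal 2⁻¹) (hwf : w false = 1) (hwt : w true = 2) :
    imhAcceptMass q w false = 1 ∧ imhAcceptMass q w true = ENNReal.ofReal (3 / 4) := by
  obtain ⟨hff, hft, htf, htt⟩ := NaiveRetryWitness.imhAcceptE_eq hwf hwt
  simp only [imhAcceptMass, NaiveRetryWitness.lintegral_eq hq, hff, hft, htf, htt, one_mul]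
  constructor
  · rw [← ENNReal.ofReal_add (by norm_num) (by norm_num)]; norm_num
  · rw [← ENNReal.ofReal_mul (by norm_num), ← ENNReal.ofReal_add (by norm_num) (by norm_num)]; norm_num

/-- The target of the witness: `π({false}) = 1/2`, `π({true}) = 1`. [ours, bookkeeping] -/
theorem NaiveRetryWitness.target_eq (hq : ∀ b, q {b} = ENNReal.ofReal 2⁻¹) (hwf : w false = 1) (hwt : w true = 2) :
    (q.withDensity fun y => ENNReal.ofReal (w y)) {false} = ENNReal.ofReal 2⁻¹ ∧
      (q.withDensity fun y => ENNReal.ofReal (w y)) {true} = 1 := by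
  constructor
  · rw [withDensity_apply _ (measurableSet_singleton _), lintegral_singleton, hq, hwf, ENNReal.ofReal_one, one_mul]
  · rw [withDensity_apply _ (measurableSet_singleton _), lintegral_singleton, hq, hwt,
      ← ENNReal.ofReal_mul (by norm_num)]
    norm_num

/-- **THE WITNESS, QUANTIFIED**: one naive-retry step from `π` puts mass `9/16` on `false` (target: `1/2 = 8/16`). [ours] -/
theorem naiveRetry_bind_apply_false (hq : ∀ b, q {b} = ENNReal.ofReal 2⁻¹) (hwf : w false = 1) (hwt : w true = 2)
    (K : Kernel Bool Bool)
    (hK : ∀ (x : Bool) {B : Set Bool}, MeasurableSet B → K x B =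
      ∫⁻ y in B, imhAcceptE w x y ∂q + (1 - imhAcceptMass q w x) * ∫⁻ y in B, imhAcceptE w x y ∂q +
        (1 - imhAcceptMass q w x) * (1 - imhAcceptMass q w x) * B.indicator 1 x) :
    ((q.withDensity fun y => ENNReal.ofReal (w y)).bind K) {false} = ENNReal.ofReal (9 / 16) := by
  obtain ⟨hff, -, htf, -⟩ := NaiveRetryWitness.imhAcceptE_eq hwf hwt
  obtain ⟨hAf, hAt⟩ := NaiveRetryWitness.imhAcceptMass_eq hq hwf hwt
  obtain ⟨hπf, hπt⟩ := NaiveRetryWitness.target_eq hq hwf hwt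
  have hKf : K false {false} = ENNReal.ofReal 2⁻¹ := by
    rw [hK false (measurableSet_singleton _), NaiveRetryWitness.setLIntegral_false_eq hq, hff, hAf, tsub_self, one_mul]
    simp only [zero_mul, add_zero]
  have hKt : K true {false} = ENNReal.ofReal (5 / 16) := by
    rw [hK true (measurableSet_singleton _), NaiveRetryWitness.setLIntegral_false_eq hq, htf, hAt,
      Set.indicator_of_notMem (by simp), mul_zero, add_zero, ← ENNReal.ofReal_one,
      ← ENNReal.ofReal_sub _ (by norm_num), ← ENNReal.ofReal_mul (by norm_num), ← ENNReal.ofReal_mul (by norm_num),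
      ← ENNReal.ofReal_add (by norm_num) (by norm_num)]
    norm_num
  rw [Measure.bind_apply (measurableSet_singleton _) (Kernel.aemeasurable _), lintegral_fintype, Fintype.sum_bool,
    hKf, hKt, hπf, hπt, mul_one, ← ENNReal.ofReal_mul (by norm_num), ← ENNReal.ofReal_add (by norm_num) (by norm_num)]
  norm_num

/-- **THE NAIVE RETRY IS NOT EXACT**: on the two-point space, for EVERY kernel realising the naive retry, `π = w·q` is NOT invariant.
[ours] -/
theorem naiveRetry_not_invariant (hq : ∀ b, q {b} = ENNReal.ofReal 2⁻¹) (hwf : w false = 1) (hwt : w true = 2)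
    (K : Kernel Bool Bool)
    (hK : ∀ (x : Bool) {B : Set Bool}, MeasurableSet B → K x B =
      ∫⁻ y in B, imhAcceptE w x y ∂q + (1 - imhAcceptMass q w x) * ∫⁻ y in B, imhAcceptE w x y ∂q +
        (1 - imhAcceptMass q w x) * (1 - imhAcceptMass q w x) * B.indicator 1 x) :
    ¬ Kernel.Invariant K (q.withDensity fun y => ENNReal.ofReal (w y)) := by
  intro h
  have h1 := congrArg (fun μ : Measure Bool => μ {false}) h.def
  rw [naiveRetry_bind_apply_false hq hwf hwt K hK, (NaiveRetryWitness.target_eq hq hwf hwt).1,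
    ENNReal.ofReal_eq_ofReal_iff (by norm_num) (by norm_num)] at h1
  norm_num at h1

/-- … and the honest version of the same algorithm IS exact there: the witness kernel's DELAYED-REJECTION twin (second draw priced by
Tierney–Mira) leaves this `π` invariant by `delayedRejection_invariant` — the bias is the price tag, not the second draw. [ours, remark:
the uniform law on `Bool` exists] -/
theorem NaiveRetryWitness.uniform_exists : ∃ q : Measure Bool, IsProbabilityMeasure q ∧ ∀ b, q {b} = ENNReal.ofReal 2⁻¹ := by
  refine ⟨ENNReal.ofReal 2⁻¹ • Measure.dirac false + ENNReal.ofReal 2⁻¹ • Measure.dirac true, ⟨?_⟩, fun b => ?_⟩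
  · rw [Measure.add_apply, Measure.smul_apply, Measure.smul_apply, measure_univ, measure_univ, smul_eq_mul, mul_one,
      ← ENNReal.ofReal_add (by norm_num) (by norm_num)]
    norm_num
  · cases b <;> simp [Measure.dirac_apply']

end NaiveRetryWitness

end Summit.Ventures.LatticeQCDFlow.Exactness
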